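import Mathlib
import HarnessLib
import Summits.HubbardSuperconductivity.HubbardSuperconductivity.Theorems.KLProgrammeKLRegimeVolumeLimitBoundGlue

/-!
# Child `KLRegimeVolumeLimitV12` (stmt-HubbardSuperconductivity-19858), stub `stub_vl_bound` — second glue: the `L`-uniform bound of the limit
# ((Z2) of `…VolumeLimitBoundGlue`) is NOT needed if the bare carrier converges PER LABEL to a bounded limit (the two-point identification
# (H)+(F) of TAU-BRIDGE.md); (Z1) + per-label two-point limits ⟹ the registered stub (seat hubbard-kl-k3c5-p3, «OS-positivity-free direct assembly»)

`…VolumeLimitBoundGlue` closes `stub_vl_bound` from (Z1) (L¹(du)-convergence of the word six-point function at fixed `L`) and (Z2) (an `L`-uniform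
bound of the limit transform — the composite trace formula).  Here (Z2) is REPLACED by the per-label convergence of the bare spin-`↑` carrier
`Σ̂⁰_{L,M}((ω,p),↑)` (labels `ω` with `matsubaraInt M ω = n`) to limits `σH n p` with `‖σH n p‖ ≤ BH` uniformly in `L, n, p` — which is what the
τ-resolved TWO-point identification gives (k3c5-p2: `(ĝ − 𝒢_L)(−ik₀+ξ)²`, `‖·‖ ≤ |U|(2+β|U|)`, `…ThermalGreenHubbardTorusExact`).  Mechanism
(`eventually_norm_klSelfEnergy_bare_le_of_Z1_twoPoint`): by `…Occupation` + `sixPoint_up_eq_integral_word`,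
`Σ̂⁰_{L,M}(k,↑) = U·occ_M + U²·I_M(k)/D_M` with `I_M(k) = ∫₀^βΣ_z e^{−iω_k u}conj χ_{k⃗}(z) S_M(z,u)du`; (Z1) makes `Σ̂⁰_{L,M}(k,↑)` close to
`T∞(n_k,k⃗) := U·occ∞ + U²·I∞(n_k,k⃗)/D∞` UNIFORMLY in the label; per label the two-point limit identifies `T∞ = σH`, so `‖T∞‖ ≤ BH` and
eventually `‖Σ̂⁰_{L,M}(k,↑)‖ ≤ BH + 1` for all `k`.  Then `stub_vl_bound_of_Z1_twoPoint` feeds the door.  Everything is proved; no definition.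
-/

noncomputable section

namespace Summit.HubbardSuperconductivity.HubbardSuperconductivity.Theorems.TwoPointAssembly

set_option linter.dupNamespace false -- summit = problem name (single-conjunct summit), D-0017

open Finset Filter Topology MeasureTheory intervalIntegral Literature.MathematicalPhysics.QuantumLattice Literature.Probability.LatticeModels
  GrassmannAlgebra
open Summit.HubbardSuperconductivity.HubbardSuperconductivity.Theorems.KLRegimeSplit
open Summit.HubbardSuperconductivity.HubbardSuperconductivity.Theorems.KLProgrammeLegKernels
open scoped ComplexConjugate

variable {L M : ℕ} [NeZero L]

omit [NeZero L] in
/-- Every integer label `n` with `|n| < M` is the Matsubara integer of some index at cutoff `M`. -/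
theorem exists_matsubaraIdx_of_natAbs_lt {n : ℤ} {M : ℕ} (h : n.natAbs < M) : ∃ ω : MatsubaraIdx M, matsubaraInt M ω = n := by
  refine ⟨⟨(n + M).toNat, by omega⟩, ?_⟩
  simp only [matsubaraInt]
  omega

/-- **THE SECOND GLUE, at one volume `L ≥ 3`.**  (Z1) at `L` + per-label two-point limits bounded by `BH` ⟹ eventually in `M`, for every
label `k`, `‖Σ̂⁰_{L,M}(k,↑)‖ ≤ BH + 1`. -/
theorem eventually_norm_klSelfEnergy_bare_le_of_Z1_twoPoint (hL : 3 ≤ L) {β : ℝ} (hβ : 0 < β) (U μ : ℝ)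
    (Sinf : TorusSite 2 L → ℝ → ℂ) (hSi : ∀ z, IntervalIntegrable (Sinf z) volume 0 β) (Dinf : ℂ) (hDinf : Dinf ≠ 0)
    (hD : Tendsto (fun M : ℕ => effPartitionFn ℂ (hubbardCovariance L M β μ 0) (hubbardInteraction L M β U)) atTop (𝓝 Dinf))
    (hS : ∀ z : TorusSite 2 L, Tendsto (fun M : ℕ => ∫ u in (0 : ℝ)..β,
        ‖gaussExpect ℂ (hubbardCovariance L M β μ 0) (grassmannExp (-(hubbardInteraction L M β U)) * sixPointWord L M β 0 1 z u) -
          Sinf z u‖) atTop (𝓝 0))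
    {BH : ℝ}
    (h2 : ∀ (n : ℤ) (p : TorusSite 2 L), ∃ σH : ℂ, ‖σH‖ ≤ BH ∧ ∀ ε : ℝ, 0 < ε → ∃ M₁ : ℕ, ∀ M : ℕ, M₁ ≤ M →
      ∀ ω : MatsubaraIdx M, matsubaraInt M ω = n → ‖klSelfEnergy L M β U μ 0 klE0 (nScales β + 1) (ω, p) 0 - σH‖ ≤ ε) :
    ∀ᶠ M : ℕ in atTop, ∀ k : FreqMomentum L M, ‖klSelfEnergy L M β U μ 0 klE0 (nScales β + 1) k 0‖ ≤ BH + 1 := by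
  have hDpos : 0 < ‖Dinf‖ := norm_pos_iff.mpr hDinf
  -- the occupation ratio and its limit (spin `↓` = `1 − 0`)
  set occ : ℕ → ℂ := fun M => (((1 / (β * (L : ℝ) ^ 2) ^ 2 : ℝ) : ℂ)) *
      (∑ q : FreqMomentum L M,
        gaussExpect ℂ (hubbardCovariance L M β μ 0)
          (gen ℂ (((q, 1), 0) : HubbardFieldIdx L M) * gen ℂ (((q, 1), 1) : HubbardFieldIdx L M) *
            grassmannExp (-(hubbardInteraction L M β U)))) /
      effPartitionFn ℂ (hubbardCovariance L M β μ 0) (hubbardInteraction L M β U) with hocc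
  set occinf : ℂ := hubbardThermalTwoPoint β U (μ + U / 2) L 0 0 1 1 - 1 / 2 with hoccinf
  have hocc_t : Tendsto occ atTop (𝓝 occinf) := tendsto_occupationRatio_allU hL hβ μ U 1 0
  -- the limit transform at an integer label and its label-free majorant
  set ψ : ℤ → TorusSite 2 L → TorusSite 2 L → ℝ → ℂ := fun n p z u =>
    Complex.exp (-(((Real.pi * (2 * (n : ℝ) + 1) / β * u : ℝ) : ℂ) * Complex.I)) * conj (torusChar p z) with hψ
  have hψnorm : ∀ n p z u, ‖ψ n p z u‖ = 1 := fun n p z u => by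
    rw [hψ]; dsimp only
    rw [norm_mul, ← neg_mul, ← Complex.ofReal_neg, Complex.norm_exp_ofReal_mul_I, Complex.norm_conj, norm_torusChar, one_mul]
  have hψc : ∀ n p z, Continuous (ψ n p z) := fun n p z => by rw [hψ]; fun_prop
  set Iinf : ℤ → TorusSite 2 L → ℂ := fun n p => ∫ u in (0 : ℝ)..β, ∑ z : TorusSite 2 L, ψ n p z u * Sinf z u with hIinf
  set Ainf : ℝ := ∫ u in (0 : ℝ)..β, ∑ z : TorusSite 2 L, ‖Sinf z u‖ with hAinf
  have hAint : IntervalIntegrable (fun u => ∑ z : TorusSite 2 L, ‖Sinf z u‖) volume 0 β := by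
    have h := IntervalIntegrable.sum (Finset.univ : Finset (TorusSite 2 L)) fun z _ => (hSi z).norm
    simpa only [Finset.sum_fn] using h
  have hA0 : 0 ≤ Ainf := intervalIntegral.integral_nonneg hβ.le fun u _ => Finset.sum_nonneg fun z _ => norm_nonneg _
  have hIinf_le : ∀ n p, ‖Iinf n p‖ ≤ Ainf := by
    intro n p
    rw [hIinf]
    refine intervalIntegral.norm_integral_le_of_norm_le hβ.le (Filter.Eventually.of_forall fun u _ => ?_) hAint
    exact (norm_sum_le _ _).trans (Finset.sum_le_sum fun z _ => by rw [norm_mul, hψnorm, one_mul])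
  set Tinf : ℤ → TorusSite 2 L → ℂ := fun n p => (U : ℂ) * occinf + (U : ℂ) ^ 2 * Iinf n p / Dinf with hTinf
  -- the finite-M word function and its transform
  set SM : (M : ℕ) → TorusSite 2 L → ℝ → ℂ := fun M z u =>
    gaussExpect ℂ (hubbardCovariance L M β μ 0) (grassmannExp (-(hubbardInteraction L M β U)) * sixPointWord L M β 0 1 z u) with hSM_def
  have hSMc : ∀ M z, Continuous (SM M z) := fun M z => continuous_wordSixPoint_up (L := L) (M := M) β U μ z
  set δ : ℕ → ℝ := fun M => ∑ z : TorusSite 2 L, ∫ u in (0 : ℝ)..β, ‖SM M z u - Sinf z u‖ with hδ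
  have hδ_t : Tendsto δ atTop (𝓝 0) := by
    have := tendsto_finsetSum (Finset.univ : Finset (TorusSite 2 L)) fun z _ => hS z
    simpa using this
  -- the key comparison at one cutoff and one label with Matsubara integer `n`
  have hcmp : ∀ (M : ℕ) (ω : MatsubaraIdx M) (p : TorusSite 2 L),
      ‖(∫ u in (0 : ℝ)..β, ∑ z : TorusSite 2 L,
          Complex.exp (-(((matsubaraFreq β M ω * u : ℝ) : ℂ) * Complex.I)) * conj (torusChar p z) * SM M z u) -
        Iinf (matsubaraInt M ω) p‖ ≤ δ M := by
    intro M ω p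
    have hφψ : (fun u => ∑ z : TorusSite 2 L,
        Complex.exp (-(((matsubaraFreq β M ω * u : ℝ) : ℂ) * Complex.I)) * conj (torusChar p z) * SM M z u) =
        fun u => ∑ z : TorusSite 2 L, ψ (matsubaraInt M ω) p z u * SM M z u := by
      funext u; rw [hψ]; simp only [matsubaraFreq]
    rw [hφψ, hIinf]
    dsimp only
    have hint1 : IntervalIntegrable (fun u => ∑ z : TorusSite 2 L, ψ (matsubaraInt M ω) p z u * SM M z u) volume 0 β :=
      (continuous_finsetSum _ fun z _ => (hψc _ _ z).mul (hSMc M z)).intervalIntegrable _ _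
    have hint2 : IntervalIntegrable (fun u => ∑ z : TorusSite 2 L, ψ (matsubaraInt M ω) p z u * Sinf z u) volume 0 β := by
      have h := IntervalIntegrable.sum (Finset.univ : Finset (TorusSite 2 L)) fun z _ =>
        ((hSi z).continuousOn_mul (hψc (matsubaraInt M ω) p z).continuousOn)
      simpa only [Finset.sum_fn] using h
    have hg : IntervalIntegrable (fun u => ∑ z : TorusSite 2 L, ‖SM M z u - Sinf z u‖) volume 0 β := by
      have h := IntervalIntegrable.sum (Finset.univ : Finset (TorusSite 2 L)) fun z _ =>
        (((hSMc M z).intervalIntegrable (0 : ℝ) β).sub (hSi z)).norm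
      simpa only [Finset.sum_fn] using h
    rw [← intervalIntegral.integral_sub hint1 hint2]
    refine (intervalIntegral.norm_integral_le_of_norm_le hβ.le (Filter.Eventually.of_forall fun u _ => ?_) hg).trans ?_
    · rw [← Finset.sum_sub_distrib]
      refine (norm_sum_le _ _).trans (Finset.sum_le_sum fun z _ => ?_)
      rw [← mul_sub, norm_mul, hψnorm, one_mul]
    · rw [intervalIntegral.integral_finsetSum fun z _ => (((hSMc M z).intervalIntegrable _ _).sub (hSi z)).norm]
  -- STEP U: uniform closeness of the carrier to `Tinf` at the label's integer
  have hU : ∀ ε : ℝ, 0 < ε → ∀ᶠ M : ℕ in atTop, ∀ k : FreqMomentum L M,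
      ‖klSelfEnergy L M β U μ 0 klE0 (nScales β + 1) k 0 - Tinf (matsubaraInt M k.1) k.2‖ ≤ ε := by
    intro ε hε
    -- the real majorant sequence
    set g : ℕ → ℝ := fun M => |U| * ‖occ M - occinf‖ + U ^ 2 * (δ M * (2 / ‖Dinf‖) +
      Ainf * ‖(effPartitionFn ℂ (hubbardCovariance L M β μ 0) (hubbardInteraction L M β U))⁻¹ - Dinf⁻¹‖) with hg
    have hg_t : Tendsto g atTop (𝓝 0) := by
      have h1 : Tendsto (fun M => ‖occ M - occinf‖) atTop (𝓝 0) := by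
        have := (hocc_t.sub_const occinf).norm
        simpa using this
      have h2 : Tendsto (fun M => ‖(effPartitionFn ℂ (hubbardCovariance L M β μ 0) (hubbardInteraction L M β U))⁻¹ - Dinf⁻¹‖)
          atTop (𝓝 0) := by
        have := ((hD.inv₀ hDinf).sub_const Dinf⁻¹).norm
        simpa using this
      have : Tendsto g atTop (𝓝 (|U| * 0 + U ^ 2 * (0 * (2 / ‖Dinf‖) + Ainf * 0))) :=
        (h1.const_mul _).add (((hδ_t.mul_const _).add (h2.const_mul _)).const_mul _)
      simpa using this
    have hDev : ∀ᶠ M : ℕ in atTop, ‖Dinf‖ / 2 ≤ ‖effPartitionFn ℂ (hubbardCovariance L M β μ 0) (hubbardInteraction L M β U)‖ := by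
      have h := hD.eventually (Metric.ball_mem_nhds Dinf (half_pos hDpos))
      filter_upwards [h] with M hM
      rw [dist_eq_norm] at hM
      have := norm_sub_norm_le Dinf (effPartitionFn ℂ (hubbardCovariance L M β μ 0) (hubbardInteraction L M β U))
      rw [← norm_neg, neg_sub] at hM
      linarith
    filter_upwards [hDev, hg_t.eventually (gt_mem_nhds hε)] with M hDM hgM k
    set D : ℂ := effPartitionFn ℂ (hubbardCovariance L M β μ 0) (hubbardInteraction L M β U) with hDdef
    have hDne : D ≠ 0 := by intro h; rw [h, norm_zero] at hDM; linarith
    have hDn : 0 < ‖D‖ := norm_pos_iff.mpr hDne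
    -- the carrier in «occupation + transform» form
    have hcar : klSelfEnergy L M β U μ 0 klE0 (nScales β + 1) k 0 = (U : ℂ) * occ M +
        (U : ℂ) ^ 2 * (∫ u in (0 : ℝ)..β, ∑ z : TorusSite 2 L,
          Complex.exp (-(((matsubaraFreq β M k.1 * u : ℝ) : ℂ) * Complex.I)) * conj (torusChar k.2 z) * SM M z u) / D := by
      rw [klSelfEnergy_nScales_succ_eq_selfEnergy_fullActionCT hβ, selfEnergy_fullActionCT_bare_eq_occupation_add hβ.ne' U μ k 0 hDne,
        mul_assoc ((U : ℂ) ^ 2), sixPoint_up_eq_integral_word hβ.ne' U μ k]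
      simp only [hocc, Fin.isValue, sub_zero]
      ring
    rw [hcar, hTinf]
    dsimp only
    set IM : ℂ := ∫ u in (0 : ℝ)..β, ∑ z : TorusSite 2 L,
      Complex.exp (-(((matsubaraFreq β M k.1 * u : ℝ) : ℂ) * Complex.I)) * conj (torusChar k.2 z) * SM M z u with hIM
    have h1 : ‖IM - Iinf (matsubaraInt M k.1) k.2‖ ≤ δ M := hcmp M k.1 k.2
    have hsplit : (U : ℂ) * occ M + (U : ℂ) ^ 2 * IM / D - ((U : ℂ) * occinf + (U : ℂ) ^ 2 * Iinf (matsubaraInt M k.1) k.2 / Dinf) =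
        (U : ℂ) * (occ M - occinf) + (U : ℂ) ^ 2 * ((IM - Iinf (matsubaraInt M k.1) k.2) * D⁻¹ +
          Iinf (matsubaraInt M k.1) k.2 * (D⁻¹ - Dinf⁻¹)) := by
      field_simp
      ring
    rw [hsplit]
    refine le_trans ?_ hgM.le
    refine (norm_add_le _ _).trans (add_le_add ?_ ?_)
    · rw [norm_mul, Complex.norm_real, Real.norm_eq_abs]
    · rw [norm_mul, norm_pow, Complex.norm_real, Real.norm_eq_abs, sq_abs]
      refine mul_le_mul_of_nonneg_left ((norm_add_le _ _).trans (add_le_add ?_ ?_)) (sq_nonneg U)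
      · rw [norm_mul, norm_inv]
        refine mul_le_mul h1 ?_ (inv_nonneg.mpr (norm_nonneg _)) ((norm_nonneg _).trans h1)
        rw [inv_eq_one_div, div_le_div_iff₀ hDn hDpos]
        linarith
      · rw [norm_mul]
        exact mul_le_mul_of_nonneg_right (hIinf_le _ _) (norm_nonneg _)
  -- STEP P: per label, `Tinf` is the two-point limit, hence bounded by `BH`
  have hP : ∀ (n : ℤ) (p : TorusSite 2 L), ‖Tinf n p‖ ≤ BH := by
    intro n p
    obtain ⟨σH, hσH, hlim⟩ := h2 n p
    have hclose : ∀ ε : ℝ, 0 < ε → ‖Tinf n p - σH‖ ≤ 2 * ε := by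
      intro ε hε
      obtain ⟨M₁, hM₁⟩ := hlim ε hε
      obtain ⟨M, hMu, hM1, hMn⟩ := ((hU ε hε).and ((eventually_ge_atTop M₁).and (eventually_gt_atTop n.natAbs))).exists
      obtain ⟨ω, hω⟩ := exists_matsubaraIdx_of_natAbs_lt hMn
      have hA := hMu (ω, p)
      rw [hω] at hA
      have hB := hM₁ M hM1 ω hω
      calc ‖Tinf n p - σH‖ = ‖(Tinf n p - klSelfEnergy L M β U μ 0 klE0 (nScales β + 1) (ω, p) 0) +
            (klSelfEnergy L M β U μ 0 klE0 (nScales β + 1) (ω, p) 0 - σH)‖ := by rw [sub_add_sub_cancel]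
        _ ≤ ε + ε := (norm_add_le _ _).trans (add_le_add (by rw [norm_sub_rev]; exact hA) hB)
        _ = 2 * ε := by ring
    have heq : Tinf n p = σH := by
      by_contra hne
      have hpos : 0 < ‖Tinf n p - σH‖ := norm_pos_iff.mpr (sub_ne_zero.mpr hne)
      have := hclose (‖Tinf n p - σH‖ / 4) (by positivity)
      linarith
    rw [heq]; exact hσH
  -- STEP F
  filter_upwards [hU 1 one_pos] with M hM k
  calc ‖klSelfEnergy L M β U μ 0 klE0 (nScales β + 1) k 0‖
      ≤ ‖Tinf (matsubaraInt M k.1) k.2‖ + ‖klSelfEnergy L M β U μ 0 klE0 (nScales β + 1) k 0 - Tinf (matsubaraInt M k.1) k.2‖ :=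
        norm_le_norm_add_norm_sub' _ _
    _ ≤ BH + 1 := add_le_add (hP _ _) (hM k)

/-- **`stub_vl_bound` FROM (Z1) AND THE PER-LABEL TWO-POINT LIMITS** (every `β > 0`, `U`, `μ`, `L ≥ 3`): the registered stub text verbatim. -/
theorem stub_vl_bound_of_Z1_twoPoint (BH : ℝ → ℝ → ℝ → ℝ)
    (hZ : ∀ β : ℝ, 0 < β → ∀ (U μ : ℝ) (L : ℕ) [NeZero L], 3 ≤ L →
      ∃ (Sinf : TorusSite 2 L → ℝ → ℂ) (Dinf : ℂ), Dinf ≠ 0 ∧ (∀ z, IntervalIntegrable (Sinf z) volume 0 β) ∧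
        Tendsto (fun M : ℕ => effPartitionFn ℂ (hubbardCovariance L M β μ 0) (hubbardInteraction L M β U)) atTop (𝓝 Dinf) ∧
        (∀ z : TorusSite 2 L, Tendsto (fun M : ℕ => ∫ u in (0 : ℝ)..β,
          ‖gaussExpect ℂ (hubbardCovariance L M β μ 0) (grassmannExp (-(hubbardInteraction L M β U)) * sixPointWord L M β 0 1 z u) -
            Sinf z u‖) atTop (𝓝 0)) ∧
        (∀ (n : ℤ) (p : TorusSite 2 L), ∃ σH : ℂ, ‖σH‖ ≤ BH β U μ ∧ ∀ ε : ℝ, 0 < ε → ∃ M₁ : ℕ, ∀ M : ℕ, M₁ ≤ M →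
          ∀ ω : MatsubaraIdx M, matsubaraInt M ω = n → ‖klSelfEnergy L M β U μ 0 klE0 (nScales β + 1) (ω, p) 0 - σH‖ ≤ ε)) :
    ∀ (G : GeoConsts) (P : SplitConsts) (Q : EngConsts) (R : RenConsts), G.WF → P.WF → Q.WF → R.WF →
      ∃ c₅ : ℝ, 0 < c₅ ∧ ∀ c : ℝ, 0 < c → c ≤ c₅ → ∃ U₀ : ℝ, 0 < U₀ ∧
        ∀ μ ∈ klWindowC, ∀ U : ℝ, 0 < U → U ≤ U₀ → ∀ β : ℝ, klBetaMin ≤ β → β ≤ Real.exp (c / U ^ 2) →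
          ∀ K : TrigPolyC4v, klPredsV12.frameOK R U (nScales β) μ K →
            ∀ (Lstar : ℕ) (Mstar : ℕ → ℕ), TowerP klPredsV12 G P Q R β U μ K Lstar Mstar →
              ∃ B : ℝ, ∃ L₀ : ℕ, ∃ Mth : ℕ → ℕ, ∀ (L : ℕ) [NeZero L], L₀ ≤ L → ∀ (M : ℕ) [NeZero M], Mth L ≤ M →
                ∀ (k : FreqMomentum L M) (σ : Fin 2), ‖klSelfEnergy L M β U μ K klE0 (nScales β + 1) k σ‖ ≤ B := by
  refine stub_vl_bound_of_bareFrameBound fun β hβ U μ => ?_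
  have hper : ∀ L : ℕ, 3 ≤ L → ∃ M₁ : ℕ, ∀ M : ℕ, M₁ ≤ M → ∀ (hL0 : NeZero L) (k : FreqMomentum L M),
      ‖klSelfEnergy L M β U μ 0 klE0 (nScales β + 1) k 0‖ ≤ BH β U μ + 1 := by
    intro L hL
    haveI : NeZero L := ⟨by omega⟩
    obtain ⟨Sinf, Dinf, hDinf, hSi, hD, hS, h2⟩ := hZ β hβ U μ L hL
    have hev := eventually_norm_klSelfEnergy_bare_le_of_Z1_twoPoint hL hβ U μ Sinf hSi Dinf hDinf hD hS h2
    obtain ⟨M₁, hM₁⟩ := Filter.eventually_atTop.mp hev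
    exact ⟨M₁, fun M hM _ k => hM₁ M hM k⟩
  obtain ⟨Mth, hMth⟩ := exists_thresholdFn hper
  exact ⟨BH β U μ + 1, 3, Mth, fun L _ hL M _ hM k => hMth L hL M hM inferInstance k⟩

end Summit.HubbardSuperconductivity.HubbardSuperconductivity.Theorems.TwoPointAssembly

end
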